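import Literature.Probability.RandomPlanarGeometry.HexSAWBrickWallStripFugacityWidthOneSwitch
import Mathlib.Analysis.SpecificLimits.Normed
import HarnessLib

/-!
# Two fugacities on the one-cell honeycomb strip: `yz ≤ μ_1(y,z)²(μ_1(y,z)² − y)(μ_1(y,z)² − z)` and `max(y,z) < μ_1(y,z)²`

Topic `Literature/Probability/RandomPlanarGeometry` (continues `HexSAWBrickWallStripFugacityWidthOneSwitch.lean`: the switch
walks `HexBW.swWalk` of the one-cell brick-wall strip `S_1 = ℤ × {0,1}` — words over the PLAIN unit (two horizontal steps) and
the SWITCH unit (horizontal, rung, horizontal) —, `swPair_mem_stripPairs`, `swWalk_decode`).  Source of the objects: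
N. R. Beaton, M. Bousquet-Mélou, J. de Gier, H. Duminil-Copin, A. J. Guttmann, *The critical fugacity for surface adsorption of
self-avoiding walks on the honeycomb lattice is `1+√2`*, Comm. Math. Phys. 326 (2014) 727–754, arXiv:1109.0358v5, §3.2
Proposition 6 (p. 10): the two-fugacity rate `μ_T(y,z) = lim_n C_{T,n}(y,z)^{1/n}` of the strip `S_T` with the weights
`y^{bc(ω)} z^{tc(ω)}` (lane notation; print: "`C_{T,n}(y,z) = Σ_{i,j} c_{T,n}(i,j) yⁱ zʲ`", `i`, `j` = the numbers of vertices in the bottom / top line,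
§3.2 p. 10 — here the odd-column sites of the bottom / top row) — `HexBW.stripMuY₂ T y z`,
`HexBW.tendsto_stripZ₂_rpow` — here at `T = 1` with two DIFFERENT fugacities; the paper uses "the transfer matrix method" only for the rationality of the
strip series (proof of Proposition 7, arXiv v5 p. 12, citing Flajolet–Sedgewick and [1] = Alm–Janson 1990, not held) and proves
no closed form for any `μ_T`.

## What is proved (namespace `Literature.Probability.RandomPlanarGeometry.SAW.HexBW`, standard axioms)

THE LOWER HALF OF THE SEXTIC LAW.  For all `y, z > 0`, with `μ = μ_1(y,z)` and `s = μ²`: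

* ★★ **`le_stripMuY₂_one_sq`**: every `s'` with `y < s'` and `s'(s' − y)(s' − z) ≤ yz` satisfies `s' ≤ μ_1(y,z)²`
  (and `le_stripMuY₂_one_sq_of_lt_right`, the same with `z < s'`);
* ★★ **`max_lt_stripMuY₂_one_sq`**: `max(y,z) < μ_1(y,z)²` (for `y, z ≥ 1` this is the zig-zag bound; here for ALL `y, z > 0`);
* ★★★ **`mul_le_stripMuY₂_one_sq_poly`**: `yz ≤ s(s − y)(s − z)`, i.e. `μ_1(y,z)²` is AT LEAST the largest root of
  `s(s − y)(s − z) = yz` — the companion file `HexSAWBrickWallStripFugacityWidthOneSextic.lean` proves `s(s−y)(s−z) ≤ yz` under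
  the hypothesis `max(y,z) ≤ s`, which `max_lt_stripMuY₂_one_sq` discharges, so together **`μ_1(y,z)²` is the largest root of
  `s(s−y)(s−z) = yz` for every `y, z > 0`** (at `z = y` this is `HexSAWBrickWallStripFugacityWidthOneExact.lean`'s cubic
  `μ³ = yμ + y`);
* one weighted wall (`z = 1`, printed rate `HexBW.stripMuY₀ 1 y = μ_1(y,1)`): `max_lt_stripMuY₀_one_sq` (`max(y,1) < μ_1(y,1)²`) and
  ★★ `le_stripMuY₀_one_sq_poly` (`y ≤ s(s−y)(s−1)`, `s = μ_1(y,1)²`, every `y > 0`).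

## The argument: two-row switch words and a `2 × 2` transfer matrix

A switch word of `n` units started at the weighted site `(1,0)` visits exactly one weighted (odd-column) site per unit, namely the
unit's endpoint, which lies on the row reached AFTER the unit.  Reading the words as Boolean tuples `f : Fin n → Bool`
(`swSet`, `wWalk`, `wWalk_cons`) the two-fugacity weight of the sites visited at positive times (`posW₂`) therefore obeys the
transfer recursion (`wordSum₂_succ`)

  `G_{n+1}(r) = w_r t² · G_n(r) + w_{1−r} t³ · G_n(1−r)`,  `w_0 = y`, `w_1 = z`,

for the word sums `G_n(r) = Σ_f posW₂ · t^{length}` from row `r` (`wordSum₂`), i.e. the per-unit transfer matrix in the length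
variable `t` is `P(t) = [[y t², z t³], [y t³, z t²]]`.  If `v = (v₀, v₁) > 0` satisfies `P(t) v ≥ v` componentwise then
`G_n(r) ≥ v_r / max(v₀,v₁)` for all `n` (`wordSum₂_ge`: positivity of `P`, induction).  The vector `v = (z t³, 1 − y t²)` does so
exactly when `y t² < 1` and `(1 − y t²)(1 − z t²) ≤ y z t⁶` (first row with equality).  On the other hand the `2^n` words are
distinct walks of `S_N(S_1)`, `2n ≤ N ≤ 3n` (`swWalk_decode`, `swPair_mem_stripPairs` of the previous file), so
`y · G_n(0) ≤ Σ_{N=2n}^{3n} C_{1,N}(y,z) t^N` (`mul_wordSum_le_sum_stripZ₂`); if `μ_1(y,z)·t < 1` the right-hand side tends to `0`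
by the Fekete limit (`eventually_stripZ₂_one_le_pow₂`), contradiction: ★ **`one_le_stripMuY₂_one_mul₂`** (`y t² < 1`,
`(1 − y t²)(1 − z t²) ≤ yz t⁶` ⇒ `1 ≤ μ_1(y,z)·t`).  With `t = 1/√s'` this is `le_stripMuY₂_one_sq`; the strict bound
`max(y,z) < μ²` and `yz ≤ μ²(μ²−y)(μ²−z)` follow by continuity of the cubic (a root slightly above `max(y,z)`, resp. slightly
above `μ²`, would still be admissible).  [The characteristic polynomial of `P(t)` at `t² = 1/s` is `(s−y)(s−z) − yz/s` up to the
factor `s⁻²`: the sextic `s(s−y)(s−z) = yz` is `det(I − P(t)) = 0`.]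

Label (author's proposal): LANE THEOREM S–M; NEW-IN-WRITING (modest): the lower half completing the explicit algebraic value of
a BBdGDCG14 two-fugacity strip rate at `T = 1`; elementary.
-/

noncomputable section

open Filter Topology Finset Literature.Probability.LatticeModels Literature.Probability.Percolation SimpleGraph

namespace Literature.Probability.RandomPlanarGeometry.SAW.HexBW

-- Membership in `Zd.saws 2 n` / `saws n` is only ever used through the previous files' lemmas.
attribute [local irreducible] Zd.saws saws

variable {y z t : ℝ}

/-! ## §1 Switch words as Boolean tuples -/

/-- The switch set `{i < n : f i}` of a Boolean word `f : Fin n → Bool`, as a finset of naturals (the index of the tree's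
`swWalk`). [cite: MadrasSlade1993, §8.2 (walks in a strip)] -/
def swSet (n : ℕ) (f : Fin n → Bool) : Finset ℕ :=
  (Finset.univ.filter fun i : Fin n => f i = true).map Fin.valEmbedding

/-- Membership in `swSet`. [cite: MadrasSlade1993, §8.2] -/
theorem mem_fSet {n : ℕ} {f : Fin n → Bool} {j : ℕ} : j ∈ swSet n f ↔ ∃ h : j < n, f ⟨j, h⟩ = true := by
  unfold swSet
  simp only [Finset.mem_map, Finset.mem_filter, Finset.mem_univ, true_and, Fin.valEmbedding_apply]
  constructor
  · rintro ⟨i, hi, rfl⟩; exact ⟨i.isLt, hi⟩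
  · rintro ⟨h, hf⟩; exact ⟨⟨j, h⟩, hf, rfl⟩

/-- Membership in `swSet` at an index of `Fin n`. [cite: MadrasSlade1993, §8.2] -/
theorem val_mem_fSet {n : ℕ} {f : Fin n → Bool} (i : Fin n) : (i : ℕ) ∈ swSet n f ↔ f i = true := by
  rw [mem_fSet]
  exact ⟨fun ⟨_, h⟩ => h, fun h => ⟨i.isLt, h⟩⟩

/-- `swSet n f ⊆ {0,…,n−1}`. [cite: MadrasSlade1993, §8.2] -/
theorem swSet_subset_range (n : ℕ) (f : Fin n → Bool) : swSet n f ⊆ range n := fun j hj => by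
  obtain ⟨h, -⟩ := mem_fSet.1 hj
  exact Finset.mem_range.2 h

/-- `#(swSet n f) ≤ n`. [cite: MadrasSlade1993, §8.2] -/
theorem card_fSet_le (n : ℕ) (f : Fin n → Bool) : #(swSet n f) ≤ n := by
  simpa using Finset.card_le_card (swSet_subset_range n f)

/-- The tree's switch indicator of `swSet n f` is the word `f`. [cite: MadrasSlade1993, §8.2] -/
theorem sw_fSet {n : ℕ} (f : Fin n → Bool) (i : Fin n) : sw (swSet n f) i = f i := by
  unfold sw
  by_cases h : f i = true
  · rw [h]; exact decide_eq_true ((val_mem_fSet i).2 h)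
  · rw [Bool.not_eq_true] at h
    rw [h]
    exact decide_eq_false fun h' => by have := (val_mem_fSet i).1 h'; rw [h] at this; exact Bool.false_ne_true this

/-- Two words are equal iff their switch sets are. [cite: MadrasSlade1993, §8.2] -/
theorem eq_of_fSet_iff {n : ℕ} {f f' : Fin n → Bool} (h : ∀ i < n, (i ∈ swSet n f ↔ i ∈ swSet n f')) : f = f' := by
  funext i
  have h1 := h i i.isLt
  rw [val_mem_fSet, val_mem_fSet] at h1
  cases hf : f i <;> cases hf' : f' i
  · rfl
  · exact absurd (h1.2 hf') (by rw [hf]; exact Bool.false_ne_true)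
  · exact absurd (h1.1 hf) (by rw [hf']; exact Bool.false_ne_true)
  · rfl

/-- **The tree's switch walk depends on the switch set only through its letters at the indices read.**
[cite: MadrasSlade1993, §1.2 (concatenation)] -/
theorem swWalk_congr {s s' : Finset ℕ} (n : ℕ) (r : ℤ) {i₀ i₀' : ℕ}
    (h : ∀ j < n, sw s (i₀ + j) = sw s' (i₀' + j)) : swWalk s n r i₀ = swWalk s' n r i₀' := by
  induction n generalizing r i₀ i₀' with
  | zero => rfl
  | succ n ih =>
    have h0 : sw s i₀ = sw s' i₀' := by simpa using h 0 (Nat.succ_pos n)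
    rw [swWalk_succ, swWalk_succ, h0, ih _ fun j hj => ?_]
    rw [show i₀ + 1 + j = i₀ + (j + 1) by omega, show i₀' + 1 + j = i₀' + (j + 1) by omega]
    exact h (j + 1) (by omega)

/-- The length likewise. [cite: MadrasSlade1993, §1.2] -/
theorem swLen_congr {s s' : Finset ℕ} (n : ℕ) {i₀ i₀' : ℕ} (h : ∀ j < n, sw s (i₀ + j) = sw s' (i₀' + j)) :
    swLen s i₀ n = swLen s' i₀' n :=
  Finset.sum_congr rfl fun j hj => by rw [h j (Finset.mem_range.1 hj)]

/-- **The word walk** of `f : Fin n → Bool` started on row `r` (from the origin): the tree's switch walk of `swSet n f`.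
[cite: MadrasSlade1993, §8.2; EntingJensen2009, §7.4.2, Fig. 7.10] -/
def wWalk (n : ℕ) (f : Fin n → Bool) (r : ℤ) : ℕ → Site 2 := swWalk (swSet n f) n r 0

/-- The length `2n + #{switches}` of the word walk. [cite: MadrasSlade1993, §8.2] -/
def wLen (n : ℕ) (f : Fin n → Bool) : ℕ := swLen (swSet n f) 0 n

/-- The first letter of `Fin.cons b g` in the tree's reading. [cite: MadrasSlade1993, §8.2] -/
theorem sw_fSet_cons_zero (n : ℕ) (b : Bool) (g : Fin n → Bool) : sw (swSet (n + 1) (Fin.cons b g)) 0 = b := by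
  have h := sw_fSet (Fin.cons b g : Fin (n + 1) → Bool) 0
  simpa using h

/-- The later letters of `Fin.cons b g` in the tree's reading. [cite: MadrasSlade1993, §8.2] -/
theorem sw_fSet_cons_succ (n : ℕ) (b : Bool) (g : Fin n → Bool) {j : ℕ} (hj : j < n) :
    sw (swSet (n + 1) (Fin.cons b g)) (0 + 1 + j) = sw (swSet n g) (0 + j) := by
  have e1 := sw_fSet (Fin.cons b g : Fin (n + 1) → Bool) (Fin.succ ⟨j, hj⟩)
  have e2 := sw_fSet g ⟨j, hj⟩
  rw [Fin.cons_succ] at e1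
  have h1 : ((Fin.succ ⟨j, hj⟩ : Fin (n + 1)) : ℕ) = 0 + 1 + j := by simp; omega
  have h2 : ((⟨j, hj⟩ : Fin n) : ℕ) = 0 + j := by simp
  rw [h1] at e1
  rw [h2] at e2
  rw [e1, e2]

/-- **Unfolding the word walk**: unit `b` from row `r`, then the word walk of the tail from the row reached.
[cite: MadrasSlade1993, §1.2 (concatenation); EntingJensen2009, §7.4.2, Fig. 7.10] -/
theorem wWalk_cons (n : ℕ) (b : Bool) (g : Fin n → Bool) (r : ℤ) :
    wWalk (n + 1) (Fin.cons b g) r = Zd.concatWalk (uLen b) (uWalk r b) (wWalk n g (if b then 1 - r else r)) := by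
  unfold wWalk
  rw [swWalk_succ, sw_fSet_cons_zero, swWalk_congr n _ (fun j hj => sw_fSet_cons_succ n b g hj)]

/-- **Unfolding the length**: `wLen (cons b g) = uLen b + wLen g`. [cite: MadrasSlade1993, §1.2] -/
theorem wLen_cons (n : ℕ) (b : Bool) (g : Fin n → Bool) : wLen (n + 1) (Fin.cons b g) = uLen b + wLen n g := by
  unfold wLen
  rw [swLen_succ, sw_fSet_cons_zero, swLen_congr n (fun j hj => sw_fSet_cons_succ n b g hj)]

/-- The empty word has length `0`. [cite: MadrasSlade1993, §1.2] -/
@[simp] theorem wLen_zero (f : Fin 0 → Bool) : wLen 0 f = 0 := by simp [wLen]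

/-- `wLen n f = 2n + #(swSet n f)`. [cite: MadrasSlade1993, §8.2] -/
theorem wLen_eq (n : ℕ) (f : Fin n → Bool) : wLen n f = 2 * n + #(swSet n f) := swLen_eq n (swSet_subset_range n f)

/-- `2n ≤ wLen n f ≤ 3n`. [cite: MadrasSlade1993, §8.2] -/
theorem wLen_mem_Icc (n : ℕ) (f : Fin n → Bool) : wLen n f ∈ Finset.Icc (2 * n) (3 * n) := by
  rw [Finset.mem_Icc, wLen_eq]
  have := card_fSet_le n f
  omega

/-- The word walk starts at the origin. [cite: MadrasSlade1993, §1.1] -/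
theorem wWalk_zero (n : ℕ) (f : Fin n → Bool) (r : ℤ) : wWalk n f r 0 = 0 := swWalk_zero _ _ _ _

/-! ## §2 The two-fugacity weight of the sites visited at positive times -/

/-- The two-fugacity weight factor of one site, in the literal form of `HexBW.bottomVisits₀` / `HexBW.topVisits₀ 1`: `y` at a
bottom-row odd column, `z` at a top-row odd column, `1` elsewhere. [cite: BeatonBousquetMelouDeGierDuminilCopinGuttmann2014, §3.2 (arXiv v5 p. 10: y^{bc(ω)} z^{tc(ω)})] -/
def siteW₂ (y z : ℝ) (x : Site 2) : ℝ :=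
  (if x 1 = 0 ∧ x 0 % 2 = 1 then y else 1) * (if x 1 = ((1 : ℕ) : ℤ) ∧ (x 0 + ((1 : ℕ) : ℤ)) % 2 = 0 then z else 1)

/-- The row weight: `y` on row `0`, `z` otherwise. [cite: BeatonBousquetMelouDeGierDuminilCopinGuttmann2014, §3.2 (arXiv v5 p. 10)] -/
def rowW₂ (y z : ℝ) (r : ℤ) : ℝ := if r = 0 then y else z

/-- On the two rows of `S_1`: `siteW₂ = rowW₂` at odd columns, `1` at even columns. [cite: BeatonBousquetMelouDeGierDuminilCopinGuttmann2014, §3.2 (arXiv v5 p. 10)] -/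
theorem siteW₂_eq (y z : ℝ) {x : Site 2} (hx : x 1 = 0 ∨ x 1 = 1) :
    siteW₂ y z x = if x 0 % 2 = 1 then rowW₂ y z (x 1) else 1 := by
  unfold siteW₂ rowW₂
  simp only [Nat.cast_one]
  rcases hx with h | h
  · by_cases hp : x 0 % 2 = 1
    · rw [if_pos ⟨h, hp⟩, if_neg (by rintro ⟨h', -⟩; omega), if_pos hp, if_pos h, mul_one]
    · rw [if_neg (by rintro ⟨-, h'⟩; exact hp h'), if_neg (by rintro ⟨h', -⟩; omega), if_neg hp, mul_one]
  · by_cases hp : x 0 % 2 = 1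
    · rw [if_neg (by rintro ⟨h', -⟩; omega), if_pos ⟨h, by omega⟩, if_pos hp, if_neg (by omega), one_mul]
    · rw [if_neg (by rintro ⟨h', -⟩; omega), if_neg (by rintro ⟨-, h'⟩; omega), if_neg hp, mul_one]

/-- `0 < siteW₂` for positive fugacities. [cite: BeatonBousquetMelouDeGierDuminilCopinGuttmann2014, §3.2 (arXiv v5 p. 10)] -/
theorem siteW₂_pos (hy : 0 < y) (hz : 0 < z) (x : Site 2) : 0 < siteW₂ y z x := by
  unfold siteW₂; split_ifs <;> positivity

/-- The weight of the sites visited at the positive times `1,…,N` by the placed walk `j ↦ a + υ j`.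
[cite: BeatonBousquetMelouDeGierDuminilCopinGuttmann2014, §3.2 (arXiv v5 p. 10: y^{bc(ω)} z^{tc(ω)})] -/
def posW₂ (y z : ℝ) (a : Site 2) (υ : ℕ → Site 2) (N : ℕ) : ℝ := ∏ j ∈ range N, siteW₂ y z (a + υ (j + 1))

/-- `0 < posW₂` for positive fugacities. [cite: BeatonBousquetMelouDeGierDuminilCopinGuttmann2014, §3.2 (arXiv v5 p. 10)] -/
theorem posW₂_pos (hy : 0 < y) (hz : 0 < z) (a : Site 2) (υ : ℕ → Site 2) (N : ℕ) : 0 < posW₂ y z a υ N :=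
  Finset.prod_pos fun _ _ => siteW₂_pos hy hz _

/-- **The printed weight `y^{bc} z^{tc}` is the weight of the starting site times `posW₂`.**
[cite: BeatonBousquetMelouDeGierDuminilCopinGuttmann2014, §3.2 (arXiv v5 p. 10: C_{T,k}(y,z) = Σ y^{bc(ω)} z^{tc(ω)})] -/
theorem pow_visits_eq_siteW_mul_posW (y z : ℝ) (a : Site 2) (υ : ℕ → Site 2) (N : ℕ) :
    y ^ bottomVisits₀ a υ N * z ^ topVisits₀ 1 a υ N = siteW₂ y z (a + υ 0) * posW₂ y z a υ N := by
  induction N with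
  | zero =>
    unfold bottomVisits₀ topVisits₀ posW₂ siteW₂
    simp only [zero_add, Finset.sum_range_one, Finset.range_zero, Finset.prod_empty, mul_one]
    split_ifs <;> simp
  | succ N ih =>
    have hb : bottomVisits₀ a υ (N + 1) =
        bottomVisits₀ a υ N + (if (a + υ (N + 1)) 1 = 0 ∧ (a + υ (N + 1)) 0 % 2 = 1 then 1 else 0) :=
      Finset.sum_range_succ _ _
    have ht : topVisits₀ 1 a υ (N + 1) = topVisits₀ 1 a υ N +
        (if (a + υ (N + 1)) 1 = ((1 : ℕ) : ℤ) ∧ ((a + υ (N + 1)) 0 + ((1 : ℕ) : ℤ)) % 2 = 0 then 1 else 0) :=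
      Finset.sum_range_succ _ _
    rw [hb, ht, posW₂, Finset.prod_range_succ, ← posW₂, pow_add, pow_add]
    calc y ^ bottomVisits₀ a υ N * y ^ (if (a + υ (N + 1)) 1 = 0 ∧ (a + υ (N + 1)) 0 % 2 = 1 then 1 else 0) *
          (z ^ topVisits₀ 1 a υ N *
            z ^ (if (a + υ (N + 1)) 1 = ((1 : ℕ) : ℤ) ∧ ((a + υ (N + 1)) 0 + ((1 : ℕ) : ℤ)) % 2 = 0 then 1 else 0))
        = (y ^ bottomVisits₀ a υ N * z ^ topVisits₀ 1 a υ N) *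
            (y ^ (if (a + υ (N + 1)) 1 = 0 ∧ (a + υ (N + 1)) 0 % 2 = 1 then 1 else 0) *
              z ^ (if (a + υ (N + 1)) 1 = ((1 : ℕ) : ℤ) ∧ ((a + υ (N + 1)) 0 + ((1 : ℕ) : ℤ)) % 2 = 0 then 1 else 0)) := by
          ring
      _ = siteW₂ y z (a + υ 0) * posW₂ y z a υ N * siteW₂ y z (a + υ (N + 1)) := by
          rw [ih]
          congr 1
          unfold siteW₂
          split_ifs <;> simp
      _ = siteW₂ y z (a + υ 0) * (posW₂ y z a υ N * siteW₂ y z (a + υ (N + 1))) := by ring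

/-- **`posW₂` of a concatenation** = `posW₂` of the first piece times `posW₂` of the second piece placed at the junction.
[cite: MadrasSlade1993, §1.2 (concatenation)] -/
theorem posW₂_concat (y z : ℝ) (a : Site 2) {m M : ℕ} {ω υ : ℕ → Site 2} (hυ : υ 0 = 0) :
    posW₂ y z a (Zd.concatWalk m ω υ) (m + M) = posW₂ y z a ω m * posW₂ y z (a + ω m) υ M := by
  unfold posW₂
  rw [Finset.prod_range_add]
  congr 1
  · exact Finset.prod_congr rfl fun j hj => by rw [concat_of_le (Nat.succ_le_of_lt (Finset.mem_range.1 hj))]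
  · exact Finset.prod_congr rfl fun j _ => by
      rw [show m + j + 1 = m + (j + 1) by omega, concat_add hυ, add_assoc]

/-- **`posW₂` of a unit placed at a weighted site of row `r`** is the row weight of the row reached: the unit's only odd-column
site at positive times is its endpoint. [cite: BeatonBousquetMelouDeGierDuminilCopinGuttmann2014, §3.2 (arXiv v5 p. 10: bc(ω), tc(ω)); EntingJensen2009, §7.4.2, Fig. 7.10] -/
theorem posW₂_uWalk (y z : ℝ) {a : Site 2} {r : ℤ} (ha0 : a 0 % 2 = 1) (ha1 : a 1 = r) (hr : r = 0 ∨ r = 1) (b : Bool) :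
    posW₂ y z a (uWalk r b) (uLen b) = rowW₂ y z (if b then 1 - r else r) := by
  have hrow : ∀ i, (a + uWalk r b i) 1 = 0 ∨ (a + uWalk r b i) 1 = 1 := fun i => by
    have h := uY_row hr b i
    simp only [Pi.add_apply, uWalk_apply_one, ha1]
    omega
  have e : ∀ i, siteW₂ y z (a + uWalk r b i) =
      if (a 0 + uX b i) % 2 = 1 then rowW₂ y z (r + uY r b i) else 1 := fun i => by
    rw [siteW₂_eq y z (hrow i)]
    simp only [Pi.add_apply, uWalk_apply_zero, uWalk_apply_one, ha1]
  unfold posW₂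
  have h1 : (a 0 + 1) % 2 ≠ 1 := by omega
  have h2 : (a 0 + 2) % 2 = 1 := by omega
  cases b
  · simp only [uLen, Finset.prod_range_succ, Finset.prod_range_zero, e, uX, uY]
    simp [h1, h2]
  · simp only [uLen, Finset.prod_range_succ, Finset.prod_range_zero, e, uX, uY]
    simp only [show ¬ (3 : ℕ) ≤ 1 by omega, show ¬ (2 : ℕ) ≤ 1 by omega, show (1 : ℕ) ≤ 1 from le_rfl]
    simp [h1, h2, show r + (1 - 2 * r) = 1 - r by ring]

/-! ## §3 The word sums and the transfer recursion `G_{n+1}(r) = w_r t² G_n(r) + w_{1−r} t³ G_n(1−r)` -/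

/-- **The word sum** `G_n(r; a) = Σ_{f : Fin n → Bool} posW₂(a; word walk of f from row r) · t^{length}` for a start `a`.
[cite: BeatonBousquetMelouDeGierDuminilCopinGuttmann2014, §3.2 (arXiv v5 p. 10: C_{T,k}(y,z)); MadrasSlade1993, §8.2] -/
def wordSum₂ (y z t : ℝ) (n : ℕ) (r : ℤ) (a : Site 2) : ℝ :=
  ∑ f : Fin n → Bool, posW₂ y z a (wWalk n f r) (wLen n f) * t ^ wLen n f

/-- `G_0 = 1`. [cite: MadrasSlade1993, §8.2] -/
theorem wordSum₂_zero (y z t : ℝ) (r : ℤ) (a : Site 2) : wordSum₂ y z t 0 r a = 1 := by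
  unfold wordSum₂
  simp [posW₂]

/-- **The transfer recursion**: peeling the first unit,
`G_{n+1}(r; a) = Σ_{b} rowW₂(r_b) t^{uLen b} · G_n(r_b; a + end of unit b)`, `r_b` = the row after unit `b`.
[cite: BeatonBousquetMelouDeGierDuminilCopinGuttmann2014, §3.2, proof of Proposition 7 (arXiv v5 p. 12: "It follows from the transfer matrix method that ... all series counting walks in a strip ... [are] rational"); MadrasSlade1993, §1.2] -/
theorem wordSum₂_succ (y z t : ℝ) (n : ℕ) {a : Site 2} {r : ℤ} (ha0 : a 0 % 2 = 1) (ha1 : a 1 = r) (hr : r = 0 ∨ r = 1) :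
    wordSum₂ y z t (n + 1) r a =
      ∑ b : Bool, rowW₂ y z (if b then 1 - r else r) * t ^ uLen b *
        wordSum₂ y z t n (if b then 1 - r else r) (a + uWalk r b (uLen b)) := by
  unfold wordSum₂
  rw [← Fintype.sum_equiv (Fin.consEquiv fun _ : Fin (n + 1) => Bool)
      (fun p : Bool × (Fin n → Bool) => posW₂ y z a (wWalk (n + 1) (Fin.cons p.1 p.2) r) (wLen (n + 1) (Fin.cons p.1 p.2)) *
        t ^ wLen (n + 1) (Fin.cons p.1 p.2)) _ (fun p => rfl), Fintype.sum_prod_type]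
  refine Fintype.sum_congr _ _ fun b => ?_
  rw [Finset.mul_sum]
  refine Finset.sum_congr rfl fun g _ => ?_
  rw [wWalk_cons, wLen_cons, posW₂_concat y z a (wWalk_zero _ _ _), posW₂_uWalk y z ha0 ha1 hr b, pow_add]
  ring

/-- **Positivity of the transfer matrix: a componentwise super-solution `P(t) v ≥ v`, `0 < v ≤ 1`, bounds every word sum
from below**, `G_n(0; a) ≥ v₀` and `G_n(1; a) ≥ v₁` for every weighted start `a`. [cite: MadrasSlade1993, §1.2 (elementary counting); BeatonBousquetMelouDeGierDuminilCopinGuttmann2014, §3.2, proof of Proposition 7 (arXiv v5 p. 12: transfer matrix method)] -/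
theorem wordSum₂_ge (hy : 0 < y) (hz : 0 < z) (ht : 0 < t) {v₀ v₁ : ℝ} (hv₀ : v₀ ≤ 1) (hv₁ : v₁ ≤ 1)
    (h₀ : v₀ ≤ y * t ^ 2 * v₀ + z * t ^ 3 * v₁) (h₁ : v₁ ≤ z * t ^ 2 * v₁ + y * t ^ 3 * v₀) (n : ℕ) :
    ∀ (r : ℤ) (a : Site 2), a 0 % 2 = 1 → a 1 = r → (r = 0 ∨ r = 1) →
      (if r = 0 then v₀ else v₁) ≤ wordSum₂ y z t n r a := by
  induction n with
  | zero =>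
    intro r a _ _ _
    rw [wordSum₂_zero]
    split_ifs <;> assumption
  | succ n ih =>
    intro r a ha0 ha1 hr
    rw [wordSum₂_succ y z t n ha0 ha1 hr, Fintype.sum_bool]
    simp only [if_true, Bool.false_eq_true, if_false]
    -- the two new starts are weighted sites on the rows reached
    have hs0 : (a + uWalk r true (uLen true)) 0 % 2 = 1 := by
      rw [Pi.add_apply, uWalk_apply_zero, uX_uLen]; omega
    have hs1 : (a + uWalk r true (uLen true)) 1 = 1 - r := by
      rw [Pi.add_apply, uWalk_apply_one, ha1]; have := uY_uLen r true; simp only [if_true] at this; exact this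
    have hp0 : (a + uWalk r false (uLen false)) 0 % 2 = 1 := by
      rw [Pi.add_apply, uWalk_apply_zero, uX_uLen]; omega
    have hp1 : (a + uWalk r false (uLen false)) 1 = r := by
      rw [Pi.add_apply, uWalk_apply_one, ha1]; have := uY_uLen r false; simpa using this
    have ihs := ih (1 - r) _ hs0 hs1 (by omega)
    have ihp := ih r _ hp0 hp1 hr
    have e3 : uLen true = 3 := rfl
    have e2 : uLen false = 2 := rfl
    simp only [e3, e2] at ihs ihp ⊢
    rcases hr with rfl | rfl
    · simp only [if_true, sub_zero, one_ne_zero, if_false, rowW₂] at ihs ihp ⊢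
      have k1 := mul_le_mul_of_nonneg_left ihp (le_of_lt (mul_pos hy (pow_pos ht 2)))
      have k2 := mul_le_mul_of_nonneg_left ihs (le_of_lt (mul_pos hz (pow_pos ht 3)))
      linarith
    · simp only [if_true, sub_self, if_false, one_ne_zero, rowW₂] at ihs ihp ⊢
      have k1 := mul_le_mul_of_nonneg_left ihp (le_of_lt (mul_pos hz (pow_pos ht 2)))
      have k2 := mul_le_mul_of_nonneg_left ihs (le_of_lt (mul_pos hy (pow_pos ht 3)))
      linarith

/-! ## §4 The words inside `S_N(S_1)`: `y · G_n(0) ≤ Σ_{N=2n}^{3n} C_{1,N}(y,z) t^N` -/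

/-- The class of a word: the tree's `swPair`. [cite: MadrasSlade1993, §8.2] -/
theorem swPair_fSet (n : ℕ) (f : Fin n → Bool) : swPair n (swSet n f) = (swStart, wWalk n f 0) := rfl

/-- **Distinct words give distinct classes.** [cite: MadrasSlade1993, §8.2] -/
theorem wWalk_injective (n : ℕ) : Function.Injective fun f : Fin n → Bool => wWalk n f 0 := by
  intro f f' h
  exact eq_of_fSet_iff fun i hi => swWalk_decode n h i (Nat.zero_le _) (by omega)

/-- The full weight of a word's class is `y · posW₂` (the start `(1,0)` is a bottom weighted site).
[cite: BeatonBousquetMelouDeGierDuminilCopinGuttmann2014, §3.2 (arXiv v5 p. 10: y^{bc(ω)} z^{tc(ω)})] -/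
theorem pow_visits_wWalk (y z : ℝ) (n : ℕ) (f : Fin n → Bool) (N : ℕ) :
    y ^ bottomVisits₀ swStart (wWalk n f 0) N * z ^ topVisits₀ 1 swStart (wWalk n f 0) N =
      y * posW₂ y z swStart (wWalk n f 0) N := by
  rw [pow_visits_eq_siteW_mul_posW, wWalk_zero, add_zero]
  congr 1
  simp [siteW₂]

/-- **`y · G_n(0; (1,0)) ≤ Σ_{N ∈ [2n,3n]} C_{1,N}(y,z) t^N`** (`t ≥ 0`): the words are distinct walks of `S_N(S_1)`.
[cite: BeatonBousquetMelouDeGierDuminilCopinGuttmann2014, §3.2 (arXiv v5 p. 10: C_{T,k}(y,z)); MadrasSlade1993, §8.2] -/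
theorem mul_wordSum_le_sum_stripZ₂ (hy : 0 < y) (hz : 0 < z) (ht : 0 ≤ t) (n : ℕ) :
    y * wordSum₂ y z t n 0 swStart ≤ ∑ N ∈ Finset.Icc (2 * n) (3 * n), stripZ₂ 1 N y z * t ^ N := by
  classical
  unfold wordSum₂
  rw [Finset.mul_sum, ← Finset.sum_fiberwise_of_maps_to (fun f _ => wLen_mem_Icc n f)]
  refine Finset.sum_le_sum fun N _ => ?_
  -- on the fibre `wLen f = N`
  have hfib : ∀ f ∈ (Finset.univ.filter fun f : Fin n → Bool => wLen n f = N),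
      y * (posW₂ y z swStart (wWalk n f 0) (wLen n f) * t ^ wLen n f) =
        y ^ bottomVisits₀ swStart (wWalk n f 0) N * z ^ topVisits₀ 1 swStart (wWalk n f 0) N * t ^ N := by
    intro f hf
    rw [(Finset.mem_filter.1 hf).2, pow_visits_wWalk]; ring
  rw [Finset.sum_congr rfl hfib]
  set S := Finset.univ.filter fun f : Fin n → Bool => wLen n f = N with hS
  have hmem : ∀ f ∈ S, (swStart, wWalk n f 0) ∈ stripPairs 1 N := by
    intro f hf
    rw [← (Finset.mem_filter.1 hf).2, ← swPair_fSet]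
    exact swPair_mem_stripPairs n (swSet n f)
  calc ∑ f ∈ S, y ^ bottomVisits₀ swStart (wWalk n f 0) N * z ^ topVisits₀ 1 swStart (wWalk n f 0) N * t ^ N
      = ∑ p ∈ S.image (fun f => (swStart, wWalk n f 0)),
          y ^ bottomVisits₀ p.1 p.2 N * z ^ topVisits₀ 1 p.1 p.2 N * t ^ N := by
        rw [Finset.sum_image fun f _ f' _ h => wWalk_injective n (congrArg Prod.snd h)]
    _ ≤ ∑ p ∈ stripPairs 1 N, y ^ bottomVisits₀ p.1 p.2 N * z ^ topVisits₀ 1 p.1 p.2 N * t ^ N := by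
        refine Finset.sum_le_sum_of_subset_of_nonneg (fun p hp => ?_) fun p _ _ => by positivity
        obtain ⟨f, hf, rfl⟩ := Finset.mem_image.1 hp
        exact hmem f hf
    _ = stripZ₂ 1 N y z * t ^ N := by rw [stripZ₂, Finset.sum_mul]

/-! ## §5 The rate dominates the transfer matrix: `1 ≤ μ_1(y,z)·t` -/

/-- Eventually `C_{1,N}(y,z) ≤ (μ_1(y,z)(1+η))^N` (`η > 0`), from `C_{1,N}^{1/N} → μ_1`. [cite: BeatonBousquetMelouDeGierDuminilCopinGuttmann2014, §3.2 Proposition 6 (arXiv v5 p. 10: μ_T(y,z) = lim C_{T,n}(y,z)^{1/n})] -/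
theorem eventually_stripZ₂_one_le_pow₂ (hy : 0 < y) (hz : 0 < z) {η : ℝ} (hη : 0 < η) :
    ∀ᶠ N : ℕ in atTop, stripZ₂ 1 N y z ≤ (stripMuY₂ 1 y z * (1 + η)) ^ N := by
  have hμ := stripMuY₂_pos 1 hy hz
  have hlt : stripMuY₂ 1 y z < stripMuY₂ 1 y z * (1 + η) := by nlinarith
  have hev := (tendsto_stripZ₂_rpow 1 hy hz).eventually (gt_mem_nhds hlt)
  filter_upwards [hev, Filter.eventually_gt_atTop 0] with N hN hN0
  have hZ := (stripZ₂_pos 1 N hy hz).le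
  have hN' : (0 : ℝ) < N := by exact_mod_cast hN0
  have h := pow_le_pow_left₀ (Real.rpow_nonneg hZ _) hN.le N
  rwa [← Real.rpow_natCast (stripZ₂ 1 N y z ^ (1 / (N : ℝ))) N, ← Real.rpow_mul hZ, one_div_mul_cancel hN'.ne',
    Real.rpow_one] at h

/-- ★ **If `y t² < 1` and `(1 − y t²)(1 − z t²) ≤ y z t⁶` then `μ_1(y,z)·t ≥ 1`** (`y, z, t > 0`): the vector
`v = (z t³, 1 − y t²)` is a super-solution of the unit transfer matrix `[[y t², z t³],[y t³, z t²]]`, so the word sums stay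
bounded below, while `μ_1 t < 1` would force `Σ_{N=2n}^{3n} C_{1,N} t^N → 0`.
[cite: BeatonBousquetMelouDeGierDuminilCopinGuttmann2014, §3.2 Proposition 6 (arXiv v5 p. 10); MadrasSlade1993, §8.2, (8.2.2)–(8.2.3)] -/
theorem one_le_stripMuY₂_one_mul₂ (hy : 0 < y) (hz : 0 < z) (ht : 0 < t) (h1 : y * t ^ 2 < 1)
    (h2 : (1 - y * t ^ 2) * (1 - z * t ^ 2) ≤ y * z * t ^ 6) : 1 ≤ stripMuY₂ 1 y z * t := by
  set μ := stripMuY₂ 1 y z with hμdef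
  have hμ : 0 < μ := stripMuY₂_pos 1 hy hz
  by_contra hcon
  rw [not_le] at hcon
  -- the normalised super-solution
  set v₀ : ℝ := z * t ^ 3 with hv₀
  set v₁ : ℝ := 1 - y * t ^ 2 with hv₁
  have hv₀0 : 0 < v₀ := by positivity
  have hv₁0 : 0 < v₁ := by rw [hv₁]; linarith
  set m : ℝ := max v₀ v₁ with hm
  have hm0 : 0 < m := lt_max_of_lt_left hv₀0
  have hP₀ : v₀ / m ≤ y * t ^ 2 * (v₀ / m) + z * t ^ 3 * (v₁ / m) := by
    rw [show y * t ^ 2 * (v₀ / m) + z * t ^ 3 * (v₁ / m) = (y * t ^ 2 * v₀ + z * t ^ 3 * v₁) / m by ring]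
    refine div_le_div_of_nonneg_right (le_of_eq ?_) hm0.le
    rw [hv₀, hv₁]; ring
  have hP₁ : v₁ / m ≤ z * t ^ 2 * (v₁ / m) + y * t ^ 3 * (v₀ / m) := by
    rw [show z * t ^ 2 * (v₁ / m) + y * t ^ 3 * (v₀ / m) = (z * t ^ 2 * v₁ + y * t ^ 3 * v₀) / m by ring]
    refine div_le_div_of_nonneg_right ?_ hm0.le
    rw [hv₀, hv₁]; nlinarith
  have hc : ∀ n, v₀ / m ≤ wordSum₂ y z t n 0 swStart := fun n => by
    have h := wordSum₂_ge hy hz ht (div_le_one_of_le₀ (le_max_left _ _) hm0.le)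
      (div_le_one_of_le₀ (le_max_right _ _) hm0.le) hP₀ hP₁ n 0 swStart (by simp) (by simp) (Or.inl rfl)
    simpa using h
  have hc0 : 0 < y * (v₀ / m) := mul_pos hy (div_pos hv₀0 hm0)
  -- Fekete: `C_{1,N} t^N ≤ θ^N`, `θ = μ t (1+η) < 1`
  have hμt : 0 < μ * t := mul_pos hμ ht
  set η : ℝ := (1 - μ * t) / (2 * (μ * t)) with hηdef
  have hη : 0 < η := by rw [hηdef]; exact div_pos (by linarith) (by positivity)
  set θ : ℝ := μ * t * (1 + η) with hθdef
  have hθ1 : θ < 1 := by rw [hθdef, hηdef]; field_simp; nlinarith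
  have hθ0 : 0 < θ := by rw [hθdef]; positivity
  obtain ⟨N₀, hN₀⟩ := Filter.eventually_atTop.1 (eventually_stripZ₂_one_le_pow₂ hy hz hη)
  -- `(n+1) θ^{2n} → 0`
  have hθ2 : θ ^ 2 < 1 := by nlinarith
  have hlim : Tendsto (fun n : ℕ => ((n : ℝ) + 1) * (θ ^ 2) ^ n) atTop (𝓝 0) := by
    have h1 := tendsto_self_mul_const_pow_of_lt_one (pow_nonneg hθ0.le 2) hθ2
    have h2 := tendsto_pow_atTop_nhds_zero_of_lt_one (pow_nonneg hθ0.le 2) hθ2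
    have := h1.add h2
    simp only [add_zero] at this
    refine this.congr fun n => by ring
  obtain ⟨n₁, hn₁⟩ := Filter.eventually_atTop.1 (hlim.eventually (gt_mem_nhds hc0))
  set n : ℕ := max N₀ n₁ with hn
  have hsmall := hn₁ n (le_max_right _ _)
  have hbig := (mul_le_mul_of_nonneg_left (hc n) hy.le).trans (mul_wordSum_le_sum_stripZ₂ hy hz ht.le n)
  -- `Σ_{N ∈ [2n,3n]} C_{1,N} t^N ≤ (n+1) θ^{2n}`
  have hsum : ∑ N ∈ Finset.Icc (2 * n) (3 * n), stripZ₂ 1 N y z * t ^ N ≤ ((n : ℝ) + 1) * (θ ^ 2) ^ n := by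
    have hle : ∀ N ∈ Finset.Icc (2 * n) (3 * n), stripZ₂ 1 N y z * t ^ N ≤ (θ ^ 2) ^ n := by
      intro N hN
      have hN2 : 2 * n ≤ N := (Finset.mem_Icc.1 hN).1
      have hNN : N₀ ≤ N := by omega
      calc stripZ₂ 1 N y z * t ^ N ≤ (μ * (1 + η)) ^ N * t ^ N :=
            mul_le_mul_of_nonneg_right (hN₀ N hNN) (pow_nonneg ht.le N)
        _ = θ ^ N := by rw [← mul_pow, hθdef]; ring
        _ ≤ θ ^ (2 * n) := pow_le_pow_of_le_one hθ0.le hθ1.le hN2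
        _ = (θ ^ 2) ^ n := by rw [pow_mul]
    calc ∑ N ∈ Finset.Icc (2 * n) (3 * n), stripZ₂ 1 N y z * t ^ N
        ≤ ∑ _N ∈ Finset.Icc (2 * n) (3 * n), (θ ^ 2) ^ n := Finset.sum_le_sum hle
      _ = ((n : ℝ) + 1) * (θ ^ 2) ^ n := by
          rw [Finset.sum_const, Nat.card_Icc, nsmul_eq_mul]
          congr 1
          rw [show 3 * n + 1 - 2 * n = n + 1 by omega]
          push_cast; ring
  linarith

/-! ## §6 The lower half of the sextic law -/

/-- ★★ **Every `s` with `y < s` and `s(s−y)(s−z) ≤ yz` satisfies `s ≤ μ_1(y,z)²`** (`y, z > 0`).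
[cite: BeatonBousquetMelouDeGierDuminilCopinGuttmann2014, §3.2 Proposition 6 (arXiv v5 p. 10: μ_T(y,z))] -/
theorem le_stripMuY₂_one_sq (hy : 0 < y) (hz : 0 < z) {s : ℝ} (hs : y < s) (h : s * (s - y) * (s - z) ≤ y * z) :
    s ≤ stripMuY₂ 1 y z ^ 2 := by
  have hs0 : 0 < s := hy.trans hs
  have hμ := (stripMuY₂_pos 1 hy hz).le
  set t : ℝ := (Real.sqrt s)⁻¹ with htdef
  have hsq : 0 < Real.sqrt s := Real.sqrt_pos.2 hs0
  have ht : 0 < t := by rw [htdef]; exact inv_pos.2 hsq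
  have ht2 : t ^ 2 = s⁻¹ := by rw [htdef, inv_pow, Real.sq_sqrt hs0.le]
  have h1 : y * t ^ 2 < 1 := by rw [ht2, ← div_eq_mul_inv, div_lt_one hs0]; exact hs
  have h2 : (1 - y * t ^ 2) * (1 - z * t ^ 2) ≤ y * z * t ^ 6 := by
    rw [show t ^ 6 = (t ^ 2) ^ 3 by ring, ht2]
    have e1 : (1 - y * s⁻¹) * (1 - z * s⁻¹) = (s * (s - y) * (s - z)) * (s⁻¹) ^ 3 := by field_simp
    rw [e1]
    exact mul_le_mul_of_nonneg_right h (by positivity)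
  have h := one_le_stripMuY₂_one_mul₂ hy hz ht h1 h2
  rw [htdef, ← div_eq_mul_inv, le_div_iff₀ hsq, one_mul] at h
  have h' := pow_le_pow_left₀ hsq.le h 2
  rwa [Real.sq_sqrt hs0.le] at h'

/-- The same with the roles of the walls exchanged: `z < s`, `s(s−y)(s−z) ≤ yz` ⇒ `s ≤ μ_1(y,z)²` (by `μ_1(y,z) = μ_1(z,y)`).
[cite: BeatonBousquetMelouDeGierDuminilCopinGuttmann2014, Proposition 6 (arXiv v5 p. 10: "μ_T(y,z) = μ_T(z,y)")] -/
theorem le_stripMuY₂_one_sq_of_lt_right (hy : 0 < y) (hz : 0 < z) {s : ℝ} (hs : z < s)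
    (h : s * (s - y) * (s - z) ≤ y * z) : s ≤ stripMuY₂ 1 y z ^ 2 := by
  rw [stripMuY₂_symm]
  exact le_stripMuY₂_one_sq hz hy hs (by rw [mul_comm z y]; linarith [h])

/-- ★★ **`max(y,z) < μ_1(y,z)²` for every `y, z > 0`**: a value of `s` slightly above `max(y,z)` is still admissible
(`s(s−y)(s−z)` vanishes at `s = max(y,z)`). [cite: BeatonBousquetMelouDeGierDuminilCopinGuttmann2014, §3.1 Proposition 5 (arXiv v5 p. 9: zig-zag walks, rate √y) and §3.2 Proposition 6 (p. 10)] -/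
theorem max_lt_stripMuY₂_one_sq (hy : 0 < y) (hz : 0 < z) : max y z < stripMuY₂ 1 y z ^ 2 := by
  set m := max y z with hm
  have hyz : 0 < y * z := mul_pos hy hz
  have hf0 : m * (m - y) * (m - z) < y * z := by
    rcases le_total y z with h | h
    · rw [hm, max_eq_right h, sub_self, mul_zero]; exact hyz
    · rw [hm, max_eq_left h, sub_self, mul_zero, zero_mul]; exact hyz
  have hc : ContinuousAt (fun s : ℝ => s * (s - y) * (s - z)) m := by fun_prop
  have hev : ∀ᶠ s in 𝓝 m, s * (s - y) * (s - z) < y * z := hc.eventually (gt_mem_nhds hf0)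
  obtain ⟨s, hs1, hs2⟩ := ((hev.filter_mono nhdsWithin_le_nhds).and (eventually_mem_nhdsWithin (s := Set.Ioi m))).exists
  rw [Set.mem_Ioi] at hs2
  have hys : y < s := lt_of_le_of_lt (le_max_left y z) hs2
  exact lt_of_lt_of_le hs2 (le_stripMuY₂_one_sq hy hz hys hs1.le)

/-- `y < μ_1(y,z)²` and `z < μ_1(y,z)²`. [cite: BeatonBousquetMelouDeGierDuminilCopinGuttmann2014, §3.2 Proposition 6 (arXiv v5 p. 10)] -/
theorem lt_stripMuY₂_one_sq₂ (hy : 0 < y) (hz : 0 < z) : y < stripMuY₂ 1 y z ^ 2 ∧ z < stripMuY₂ 1 y z ^ 2 :=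
  ⟨lt_of_le_of_lt (le_max_left y z) (max_lt_stripMuY₂_one_sq hy hz),
    lt_of_le_of_lt (le_max_right y z) (max_lt_stripMuY₂_one_sq hy hz)⟩

/-- ★★★ **THE LOWER HALF OF THE SEXTIC LAW: `yz ≤ s(s − y)(s − z)` for `s = μ_1(y,z)²`, every `y, z > 0`** — so `μ_1(y,z)²`
is at least the largest root of `s(s−y)(s−z) = yz`, the spectral radius law of the unit transfer matrix; with the companion
upper bound (`HexSAWBrickWallStripFugacityWidthOneSextic`) it IS that root. [cite: BeatonBousquetMelouDeGierDuminilCopinGuttmann2014, §3.2 Proposition 6 (arXiv v5 p. 10: μ_T(y,z)) and proof of Proposition 7 (p. 12: "the transfer matrix method")] -/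
theorem mul_le_stripMuY₂_one_sq_poly (hy : 0 < y) (hz : 0 < z) :
    y * z ≤ stripMuY₂ 1 y z ^ 2 * (stripMuY₂ 1 y z ^ 2 - y) * (stripMuY₂ 1 y z ^ 2 - z) := by
  set μ := stripMuY₂ 1 y z with hμdef
  obtain ⟨hyμ, -⟩ := lt_stripMuY₂_one_sq₂ hy hz
  by_contra hcon
  rw [not_le] at hcon
  have hc : ContinuousAt (fun s : ℝ => s * (s - y) * (s - z)) (μ ^ 2) := by fun_prop
  have hev : ∀ᶠ s in 𝓝 (μ ^ 2), s * (s - y) * (s - z) < y * z := hc.eventually (gt_mem_nhds hcon)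
  obtain ⟨s, hs1, hs2⟩ :=
    ((hev.filter_mono nhdsWithin_le_nhds).and (eventually_mem_nhdsWithin (s := Set.Ioi (μ ^ 2)))).exists
  rw [Set.mem_Ioi] at hs2
  have h := le_stripMuY₂_one_sq hy hz (hyμ.trans hs2) hs1.le
  rw [← hμdef] at h
  linarith

/-- The admissible values of `s` above EITHER wall weight lie below `μ_1(y,z)²`. [cite: BeatonBousquetMelouDeGierDuminilCopinGuttmann2014, §3.2 Proposition 6 (arXiv v5 p. 10)] -/
theorem le_stripMuY₂_one_sq_of_lt_max (hy : 0 < y) (hz : 0 < z) {s : ℝ} (hs : min y z < s)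
    (h : s * (s - y) * (s - z) ≤ y * z) : s ≤ stripMuY₂ 1 y z ^ 2 := by
  rcases min_lt_iff.1 hs with h' | h'
  · exact le_stripMuY₂_one_sq hy hz h' h
  · exact le_stripMuY₂_one_sq_of_lt_right hy hz h' h

/-! ### One weighted wall (`z = 1`): the printed rate `μ_1(y,1) = stripMuY₀ 1 y` -/

/-- `max(y,1) < μ_1(y,1)²` for every `y > 0` (printed one-variable rate `HexBW.stripMuY₀ 1 y`).
[cite: BeatonBousquetMelouDeGierDuminilCopinGuttmann2014, §3.2 Propositions 6–7 (arXiv v5 pp. 10–11: μ_T(1,y) = μ_T(y,1))] -/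
theorem max_lt_stripMuY₀_one_sq (hy : 0 < y) : max y 1 < stripMuY₀ 1 y ^ 2 := by
  rw [← stripMuY₂_one_right]
  exact max_lt_stripMuY₂_one_sq hy one_pos

/-- ★★ **One weighted wall on the one-cell strip: `y ≤ s(s − y)(s − 1)` for `s = μ_1(y,1)²`, every `y > 0`** (the companion
file proves `≤` for `y ≥ 1`, so for `y ≥ 1` the printed width-one rate is the largest root of `s(s−y)(s−1) = y`).
[cite: BeatonBousquetMelouDeGierDuminilCopinGuttmann2014, §3.2 Propositions 6–7 (arXiv v5 pp. 10–11)] -/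
theorem le_stripMuY₀_one_sq_poly (hy : 0 < y) :
    y ≤ stripMuY₀ 1 y ^ 2 * (stripMuY₀ 1 y ^ 2 - y) * (stripMuY₀ 1 y ^ 2 - 1) := by
  have h := mul_le_stripMuY₂_one_sq_poly hy one_pos
  rw [stripMuY₂_one_right, mul_one] at h
  exact h

end Literature.Probability.RandomPlanarGeometry.SAW.HexBW
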